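import Literature.Combinatorics.SimpleGraph.LovaszThetaPenalty
import HarnessLib

/-!
# One Frank–Wolfe step for the Lovász number with the power-method oracle

Topic `Combinatorics/SimpleGraph`, continuing `LovaszThetaPenalty.lean`. The real-analysis core
of a first-order approximation scheme for `ϑ(H) = lovaszTheta H` — Hazan's Frank–Wolfe method
over the spectraplex `Δ` (Jaggi 2011, Alg. 6 "Hazan's algorithm": `X⁽ᵏ⁺¹⁾ = X⁽ᵏ⁾ + αₖ(vvᵀ - X⁽ᵏ⁾)`,
`v = ApproxEV(∇f(X⁽ᵏ⁾), ·)`, "adding a large enough constant `t` to the diagonal" to make the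
gradient positive semidefinite before running the power method, Thm. 17/18) applied to the
penalised objective `f_M` of `LovaszThetaPenalty.lean`, with the approximate top eigenvector
replaced by the normalised matrix power `Aʳ/Tr(Aʳ)` of `PowerMethodTrace.lean`. All PROVED:

* `frankWolfe_step` — for `B, W ∈ Δ`, a bound `Λ` on the linearised objective over `Δ` and an
  oracle guarantee `⟨∇f(B), W⟩ ≥ Λ - ε'`: with `Y = (1-α)B + αW`,
  `ϑ - f(Y) ≤ (1-α)(ϑ - f(B)) + α ε' + 4M α²` (Jaggi 2011, Lemma 4 with the approximate oracle,
  and weak duality against every theta-feasible matrix);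
* `powerOracle` — for `B ∈ Δ`, `c₀ ≥ |V|(1+2M)`, `0 ≤ ε ≤ 1` and `|V|(1-ε)ʳ ≤ ε`: the shifted
  gradient `A = ∇f(B) + c₀·1` is positive semidefinite with `Tr(Aʳ) > 0`, `W = Aʳ/Tr(Aʳ) ∈ Δ`, and
  for `Λ = λ_max(A) - c₀`: `⟨∇f(B), B'⟩ ≤ Λ` on `Δ` while `⟨∇f(B), W⟩ ≥ Λ - 4εc₀`;
* `frankWolfe_powerStep` — the two combined: `ϑ - f(Y) ≤ (1-α)(ϑ - f(B)) + 4εc₀ α + 4M α²`, `Y ∈ Δ`;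
* `abs_penaltyObj_sub_le` — stability of `f_M` under entrywise perturbations of size `δ ≤ 1`
  around a matrix with entries in `[-1, 1]`: `|f(X) - f(Y)| ≤ |V|² δ (1 + 3M)` (for rounding).

## References

* M. Jaggi, *Convex optimization without projection steps*, arXiv:1108.1170 (2011), §3 Lemma 4,
  Thm. 3; §4 Alg. 6, Thm. 17, Thm. 18 and the diagonal shift (held, chunks p0007, p0020–p0022)
  [Jaggi2011]; E. Hazan, LATIN 2008 [Hazan2008].
* G. H. Golub, C. F. Van Loan, *Matrix Computations* (2013), §8.2.1 [GolubVanLoan2013].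
-/

noncomputable section

open Matrix Finset

namespace Literature.Combinatorics.SimpleGraph

open Literature.LinearAlgebra.Matrix

variable {V : Type*} [Fintype V] [DecidableEq V]
variable {H : _root_.SimpleGraph V} [DecidableRel H.Adj]

/-! ### Small algebra of the pairing and the penalty -/

omit [DecidableEq V] in
/-- The pairing is symmetric. [folklore] -/
theorem frobInner_comm (X Y : Matrix V V ℝ) : frobInner X Y = frobInner Y X := by
  simp only [frobInner]
  exact sum_congr rfl fun u _ => sum_congr rfl fun v _ => mul_comm _ _

/-- Pairing a spectraplex matrix with the identity gives one (its trace). [folklore] -/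
theorem frobInner_one_of_isSpectraplex {B : Matrix V V ℝ} (hB : IsSpectraplex B) :
    frobInner (1 : Matrix V V ℝ) B = 1 := by
  rw [frobInner_one_left, hB.trace_eq_one]

/-- Shifting the first argument by `c · 1` shifts the pairing with a spectraplex matrix by `c`.
[folklore] -/
theorem frobInner_add_smul_one_left {X Y : Matrix V V ℝ} (hY : IsSpectraplex Y) (c : ℝ) :
    frobInner (X + c • (1 : Matrix V V ℝ)) Y = frobInner X Y + c := by
  rw [frobInner_comm, frobInner_add, frobInner_smul, frobInner_comm Y X, frobInner_comm Y 1,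
    frobInner_one_of_isSpectraplex hY, mul_one]

omit [DecidableEq V] in
/-- The penalty is quadratic: `q(a • D) = a² q(D)`. [folklore] -/
theorem edgeSqSum_smul (a : ℝ) (D : Matrix V V ℝ) : edgeSqSum H (a • D) = a ^ 2 * edgeSqSum H D := by
  simp only [edgeSqSum, Matrix.smul_apply, smul_eq_mul, mul_sum]
  exact sum_congr rfl fun u _ => sum_congr rfl fun v _ => by split_ifs <;> ring

omit [Fintype V] [DecidableEq V] in
/-- The Frank–Wolfe displacement: `(1-α)B + αW - B = α (W - B)`. [folklore] -/
theorem convexComb_sub (B W : Matrix V V ℝ) (α : ℝ) : (1 - α) • B + α • W - B = α • (W - B) := by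
  ext u v
  simp only [Matrix.sub_apply, Matrix.add_apply, Matrix.smul_apply, smul_eq_mul]
  ring

/-! ### Weak duality: the linearised objective bounds `ϑ` -/

/-- **Weak duality against the theta-feasible set**: if `⟨∇f(B), B'⟩ ≤ Λ` for all theta-feasible
`B'`, then `ϑ ≤ f(B) + Λ - ⟨∇f(B), B⟩` (Taylor identity: `f(B') = f(B) + ⟨∇f(B), B' - B⟩ - M q(B' - B)`
and `f = Σ` on feasible matrices; Jaggi 2011, §2 weak duality `ω(x) ≤ f(y)`).
[cite: Jaggi2011, §2–§3 (chunks p0004, p0007)] -/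
theorem lovaszTheta_le_linearised [Nonempty V] {M : ℝ} (hM : 0 ≤ M) (B : Matrix V V ℝ) {Λ : ℝ}
    (hΛ : ∀ B' : Matrix V V ℝ, IsThetaFeasible H B' → frobInner (penaltyGrad H M B) B' ≤ Λ) :
    lovaszTheta H ≤ penaltyObj H M B + Λ - frobInner (penaltyGrad H M B) B := by
  have hne : (entrySum '' {B' | IsThetaFeasible H B'}).Nonempty :=
    ⟨_, _, isThetaFeasible_smul_one H, rfl⟩
  refine csSup_le hne ?_
  rintro _ ⟨B', hB', rfl⟩
  have htaylor := penaltyObj_eq_taylor (H := H) M B B'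
  rw [penaltyObj_of_feasible M hB', frobInner_sub] at htaylor
  have hq := edgeSqSum_nonneg (H := H) (B' - B)
  have h1 := hΛ B' hB'
  nlinarith

/-! ### One Frank–Wolfe step with an inexact oracle -/

/-- **One Frank–Wolfe step** (Jaggi 2011, Lemma 4, approximate variant, specialised to the
concave quadratic `f_M` over the spectraplex): for `B, W ∈ Δ`, a bound `Λ` of the linearisation
over the theta-feasible set, an oracle guarantee `⟨∇f(B), W⟩ ≥ Λ - ε'` and `0 ≤ α`,
`ϑ - f((1-α)B + αW) ≤ (1-α)(ϑ - f(B)) + α ε' + 4M α²`. [cite: Jaggi2011, Lemma 4 and Thm. 3 (chunk p0007)] -/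
theorem frankWolfe_step [Nonempty V] {M : ℝ} (hM : 0 ≤ M) {B W : Matrix V V ℝ}
    (hB : IsSpectraplex B) (hW : IsSpectraplex W) {Λ ε' α : ℝ}
    (hΛ : ∀ B' : Matrix V V ℝ, IsThetaFeasible H B' → frobInner (penaltyGrad H M B) B' ≤ Λ)
    (hLMO : Λ - ε' ≤ frobInner (penaltyGrad H M B) W) (hα0 : 0 ≤ α) :
    lovaszTheta H - penaltyObj H M ((1 - α) • B + α • W)
      ≤ (1 - α) * (lovaszTheta H - penaltyObj H M B) + α * ε' + α ^ 2 * (4 * M) := by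
  have hweak := lovaszTheta_le_linearised hM B hΛ
  have htaylor := penaltyObj_eq_taylor (H := H) M B ((1 - α) • B + α • W)
  rw [convexComb_sub, frobInner_smul, frobInner_sub, edgeSqSum_smul] at htaylor
  have hq := edgeSqSum_sub_le_four (H := H) hB hW
  have hq0 := edgeSqSum_nonneg (H := H) (W - B)
  have h3 : M * (α ^ 2 * edgeSqSum H (W - B)) ≤ α ^ 2 * (4 * M) := by
    nlinarith [mul_nonneg hM (sq_nonneg α)]
  nlinarith [mul_le_mul_of_nonneg_left hLMO hα0]

/-! ### The power-method oracle -/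

/-- **The power-method oracle** (Jaggi 2011, §4: `ApproxEV` by the power method after "adding a
large enough constant `t` to the diagonal"; here with the all-start-vectors power
`Aʳ/Tr(Aʳ)` of `PowerMethodTrace.lean`). For `B ∈ Δ`, `M ≥ 0`, `c₀ ≥ |V|(1 + 2M)`, `0 ≤ ε ≤ 1` and
`|V|(1 - ε)ʳ ≤ ε`, with `G = ∇f_M(B)` and `A = G + c₀·1`: `A ⪰ 0`, `Tr(Aʳ) > 0`, and for
`Λ = λ_max(A) - c₀` one has `⟨G, B'⟩ ≤ Λ` for every `B' ∈ Δ` while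
`⟨G, Aʳ/Tr(Aʳ)⟩ ≥ Λ - 4 ε c₀`. [cite: Jaggi2011, §4, Alg. 6 and Thm. 18 (chunks p0020–p0022)] -/
theorem powerOracle [Nonempty V] {M : ℝ} (hM : 0 ≤ M) {B : Matrix V V ℝ} (hB : IsSpectraplex B)
    {c₀ : ℝ} (hc₀ : Fintype.card V * (1 + 2 * M) ≤ c₀) {ε : ℝ} (hε0 : 0 ≤ ε) (hε1 : ε ≤ 1)
    {r : ℕ} (hr : (Fintype.card V : ℝ) * (1 - ε) ^ r ≤ ε) :
    (penaltyGrad H M B + c₀ • (1 : Matrix V V ℝ)).PosSemidef ∧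
    0 < ((penaltyGrad H M B + c₀ • (1 : Matrix V V ℝ)) ^ r).trace ∧
    ∃ Λ : ℝ, (∀ B' : Matrix V V ℝ, IsSpectraplex B' → frobInner (penaltyGrad H M B) B' ≤ Λ) ∧
      Λ - 4 * ε * c₀ ≤ frobInner (penaltyGrad H M B)
        ((((penaltyGrad H M B + c₀ • (1 : Matrix V V ℝ)) ^ r).trace)⁻¹ •
          (penaltyGrad H M B + c₀ • (1 : Matrix V V ℝ)) ^ r) := by
  set G := penaltyGrad H M B with hGdef
  set A := G + c₀ • (1 : Matrix V V ℝ) with hAdef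
  set n : ℝ := (Fintype.card V : ℝ) with hn
  have hn1 : 1 ≤ n := by
    rw [hn]; exact_mod_cast Nat.one_le_iff_ne_zero.2 Fintype.card_ne_zero
  have hGsymm : ∀ u v, G v u = G u v := penaltyGrad_comm M hB.apply_comm
  have hGherm : G.IsHermitian := isHermitian_penaltyGrad M hB.apply_comm
  have hGbd : ∀ u v, |G u v| ≤ 1 + 2 * M := abs_penaltyGrad_le hM hB
  have hc₀0 : 0 ≤ c₀ := le_trans (mul_nonneg (by rw [hn]; positivity) (by linarith)) hc₀
  -- the shift into the cone
  have hA : A.PosSemidef := posSemidef_add_smul_one hGherm hGbd hc₀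
  have hAsymm : ∀ u v, A v u = A u v := fun u v => by
    have h := congrFun (congrFun hA.1 u) v
    simpa [conjTranspose_apply] using h
  have htrA : 0 < A.trace := by
    have h1 : A.trace = ∑ _u : V, (1 + c₀) := by
      simp only [hAdef, Matrix.trace, Matrix.diag, Matrix.add_apply, Matrix.smul_apply,
        Matrix.one_apply_eq, smul_eq_mul, mul_one, hGdef, penaltyGrad_diag]
    rw [h1, sum_const, card_univ, nsmul_eq_mul, ← hn]
    nlinarith
  have htrAr : 0 < (A ^ r).trace := trace_pow_pos hA htrA r
  refine ⟨hA, htrAr, topEigenvalue hA.1 - c₀, fun B' hB' => ?_, ?_⟩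
  · -- `⟨G, B'⟩ = ⟨A, B'⟩ - c₀ ≤ λ_max(A) - c₀`
    have h1 : frobInner A B' = frobInner G B' + c₀ := by
      rw [hAdef]; exact frobInner_add_smul_one_left hB' c₀
    linarith [frobInner_le_topEigenvalue hA.1 hB']
  · -- the normalised power
    set W := ((A ^ r).trace)⁻¹ • A ^ r with hWdef
    have hW : IsSpectraplex W := IsSpectraplex.of_posSemidef_div (hA.pow r) htrAr
    have hArsymm : ∀ u v, (A ^ r) v u = (A ^ r) u v := fun u v => by
      have h := congrFun (congrFun (hA.1.pow r) u) v
      simpa [conjTranspose_apply] using h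
    -- `⟨A, W⟩ ≥ (1 - ε)² λ_max(A)`
    have hAW : (1 - ε) ^ 2 * topEigenvalue hA.1 ≤ frobInner A W := by
      have h1 : frobInner A W = ((A ^ r).trace)⁻¹ * (A ^ (r + 1)).trace := by
        rw [hWdef, frobInner_smul, frobInner_eq_trace_mul A hArsymm, pow_succ']
      rw [h1, ← div_eq_inv_mul, le_div_iff₀ htrAr]
      exact trace_pow_succ_ge hA hε0 hε1 hr
    -- `λ_max(A) ≤ 2 c₀`
    have hΛA : topEigenvalue hA.1 ≤ 2 * c₀ := by
      obtain ⟨i₀, hi₀⟩ := exists_eigenvalues_eq_topEigenvalue hA.1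
      set u := (hA.1.eigenvectorBasis i₀).ofLp with hu
      have hAu : A *ᵥ u = topEigenvalue hA.1 • u := by rw [hu, hA.1.mulVec_eigenvectorBasis i₀, hi₀]
      have huu : u ⬝ᵥ u = 1 := by
        have := eigenvectorBasis_dotProduct hA.1 i₀ i₀; rwa [if_pos rfl] at this
      have hq : u ⬝ᵥ (A *ᵥ u) = topEigenvalue hA.1 := by
        rw [hAu, dotProduct_smul, huu, smul_eq_mul, mul_one]
      have hsplit : u ⬝ᵥ (A *ᵥ u) = u ⬝ᵥ (G *ᵥ u) + c₀ := by
        rw [hAdef, add_mulVec, dotProduct_add, smul_mulVec, one_mulVec, dotProduct_smul, huu,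
          smul_eq_mul, mul_one]
      have hG := abs_dotProduct_mulVec_le hGbd u
      rw [huu, mul_one, ← hn] at hG
      have hG' : u ⬝ᵥ (G *ᵥ u) ≤ n * (1 + 2 * M) := (le_abs_self _).trans hG
      linarith
    have hΛ0 : 0 ≤ topEigenvalue hA.1 := topEigenvalue_nonneg hA
    -- `⟨G, W⟩ = ⟨A, W⟩ - c₀`
    have h2 : frobInner A W = frobInner G W + c₀ := by
      rw [hAdef]; exact frobInner_add_smul_one_left hW c₀
    have hsq : (1 - 2 * ε) * topEigenvalue hA.1 ≤ (1 - ε) ^ 2 * topEigenvalue hA.1 :=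
      mul_le_mul_of_nonneg_right (by nlinarith) hΛ0
    nlinarith [mul_le_mul_of_nonneg_left hΛA hε0]

/-- **One Frank–Wolfe step with the power-method oracle** (the two previous results combined;
Jaggi 2011, Alg. 6 / Thm. 17 with Thm. 18): for `B ∈ Δ` and `W = Aʳ/Tr(Aʳ)`, `A = ∇f_M(B) + c₀·1`,
the iterate `Y = (1-α)B + αW` lies in `Δ` and `ϑ - f(Y) ≤ (1-α)(ϑ - f(B)) + α·4εc₀ + 4M α²`.
[cite: Jaggi2011, Alg. 6, Thm. 17 and Thm. 18 (chunks p0020–p0022)] -/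
theorem frankWolfe_powerStep [Nonempty V] {M : ℝ} (hM : 0 ≤ M) {B : Matrix V V ℝ}
    (hB : IsSpectraplex B) {c₀ : ℝ} (hc₀ : Fintype.card V * (1 + 2 * M) ≤ c₀) {ε : ℝ}
    (hε0 : 0 ≤ ε) (hε1 : ε ≤ 1) {r : ℕ} (hr : (Fintype.card V : ℝ) * (1 - ε) ^ r ≤ ε)
    {α : ℝ} (hα0 : 0 ≤ α) (hα1 : α ≤ 1) :
    let A := penaltyGrad H M B + c₀ • (1 : Matrix V V ℝ)
    let W := ((A ^ r).trace)⁻¹ • A ^ r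
    IsSpectraplex W ∧ IsSpectraplex ((1 - α) • B + α • W) ∧
      lovaszTheta H - penaltyObj H M ((1 - α) • B + α • W)
        ≤ (1 - α) * (lovaszTheta H - penaltyObj H M B) + α * (4 * ε * c₀) + α ^ 2 * (4 * M) := by
  intro A W
  obtain ⟨hA, htr, Λ, hΛ, hLMO⟩ := powerOracle (H := H) hM hB hc₀ hε0 hε1 hr
  have hW : IsSpectraplex W := IsSpectraplex.of_posSemidef_div (hA.pow r) htr
  refine ⟨hW, hB.convexComb hW hα0 hα1, ?_⟩
  have hLMO' : Λ - 4 * ε * c₀ ≤ frobInner (penaltyGrad H M B) W := hLMO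
  exact frankWolfe_step hM hB hW (fun B' hB' => hΛ B' (IsSpectraplex.of_isThetaFeasible hB'))
    hLMO' hα0

/-! ### Stability of the objective under entrywise perturbation -/

omit [DecidableEq V] in
/-- **Stability of `f_M`**: if `|Yᵤᵥ| ≤ 1` and `|Xᵤᵥ - Yᵤᵥ| ≤ δ ≤ 1` for all `u, v`, then
`|f(X) - f(Y)| ≤ |V|² δ (1 + 3M)` (`|Xᵤᵥ² - Yᵤᵥ²| ≤ δ(2 + δ) ≤ 3δ`). [folklore] -/
theorem abs_penaltyObj_sub_le {M : ℝ} (hM : 0 ≤ M) {X Y : Matrix V V ℝ} {δ : ℝ} (hδ0 : 0 ≤ δ)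
    (hδ1 : δ ≤ 1) (hY : ∀ u v, |Y u v| ≤ 1) (hXY : ∀ u v, |X u v - Y u v| ≤ δ) :
    |penaltyObj H M X - penaltyObj H M Y| ≤ (Fintype.card V : ℝ) ^ 2 * δ * (1 + 3 * M) := by
  have he : |entrySum X - entrySum Y| ≤ (Fintype.card V : ℝ) ^ 2 * δ := by
    rw [← entrySum_sub]
    calc |entrySum (X - Y)| ≤ ∑ u, ∑ v, |(X - Y) u v| := by
          refine (abs_sum_le_sum_abs _ _).trans (sum_le_sum fun u _ => abs_sum_le_sum_abs _ _)
      _ ≤ ∑ _u : V, ∑ _v : V, δ := sum_le_sum fun u _ => sum_le_sum fun v _ => by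
          rw [Matrix.sub_apply]; exact hXY u v
      _ = (Fintype.card V : ℝ) ^ 2 * δ := by simp [sq]; ring
  have hq : |edgeSqSum H X - edgeSqSum H Y| ≤ (Fintype.card V : ℝ) ^ 2 * (3 * δ) := by
    have hdiff : edgeSqSum H X - edgeSqSum H Y =
        ∑ u, ∑ v, if H.Adj u v then X u v ^ 2 - Y u v ^ 2 else 0 := by
      simp only [edgeSqSum, ← sum_sub_distrib]
      exact sum_congr rfl fun u _ => sum_congr rfl fun v _ => by split_ifs <;> ring
    rw [hdiff]
    calc |∑ u, ∑ v, if H.Adj u v then X u v ^ 2 - Y u v ^ 2 else 0|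
        ≤ ∑ u, ∑ v, |if H.Adj u v then X u v ^ 2 - Y u v ^ 2 else 0| := by
          refine (abs_sum_le_sum_abs _ _).trans (sum_le_sum fun u _ => abs_sum_le_sum_abs _ _)
      _ ≤ ∑ _u : V, ∑ _v : V, 3 * δ := sum_le_sum fun u _ => sum_le_sum fun v _ => by
          split_ifs
          · have h1 := hXY u v
            have h2 := hY u v
            rw [abs_le] at h1 h2 ⊢
            constructor <;> nlinarith
          · simp; positivity
      _ = (Fintype.card V : ℝ) ^ 2 * (3 * δ) := by simp [sq]; ring
  have hsplit : penaltyObj H M X - penaltyObj H M Y =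
      (entrySum X - entrySum Y) - M * (edgeSqSum H X - edgeSqSum H Y) := by
    simp only [penaltyObj]; ring
  rw [hsplit]
  calc |entrySum X - entrySum Y - M * (edgeSqSum H X - edgeSqSum H Y)|
      ≤ |entrySum X - entrySum Y| + |M * (edgeSqSum H X - edgeSqSum H Y)| := abs_sub _ _
    _ ≤ (Fintype.card V : ℝ) ^ 2 * δ + M * ((Fintype.card V : ℝ) ^ 2 * (3 * δ)) := by
        rw [abs_mul, abs_of_nonneg hM]
        exact add_le_add he (mul_le_mul_of_nonneg_left hq hM)
    _ = (Fintype.card V : ℝ) ^ 2 * δ * (1 + 3 * M) := by ring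

end Literature.Combinatorics.SimpleGraph

end
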